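import Mathlib.Analysis.Complex.UpperHalfPlane.Measure
import Mathlib.Analysis.Complex.UpperHalfPlane.ProperAction
import Mathlib.MeasureTheory.Group.ModularCharacter
import Mathlib.MeasureTheory.Measure.Haar.Unique
import Mathlib.MeasureTheory.Measure.Prod
import HarnessLib

/-!
# Haar measure on `SL(2, ℝ)`: unimodularity and the Iwasawa disintegration

Support file for the explicit Möbius-invariant loop ensemble used to discharge the named fact
`Literature.Probability.RandomPlanarGeometry.exists_isCLEFamily` (`Literature.Probability.RandomPlanarGeometry.CLE`): the random element
of `SL(2, ℝ)` driving that ensemble is sampled from (a normalised restriction of) the Haar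
measure constructed here, and the two properties used downstream are bi-invariance and the
disintegration over the orbit map `g ↦ g • i`.

## Contents

* Borel structure, Hausdorffness, second countability and local compactness of `SL(2, ℝ)` (a
  closed subset of the `2 × 2` real matrices); positivity of the hyperbolic area of open subsets
  of `ℍ` (`IsOpenPosMeasure volume`).
* **Unimodularity** (`Literature.Probability.RandomPlanarGeometry.SL2R.modularCharacter_eq_one`,
  `Literature.Probability.RandomPlanarGeometry.SL2R.isMulRightInvariant_of_isHaarMeasure`): the modular character `Δ` of `SL(2, ℝ)` is
  trivial. Proof: for the upper unipotent `u(x)` and `d = diag(√2, 1/√2)` one has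
  `d u(x) d⁻¹ = u(2x) = u(x)²`, so `Δ(u) = Δ(u)²`, i.e. `Δ(u) = 1`; likewise for lower
  unipotents; and every element of `SL(2, ℝ)` is a product of at most four unipotents
  (`Literature.Probability.RandomPlanarGeometry.SL2R.mk_eq_unipotent_prod`). Hence every Haar measure is right invariant.
* The compact stabiliser `K = Stab(i)` with its Haar probability measure `haarK`, the
  **Iwasawa section** `s(x + iy) = (√y, x/√y; 0, 1/√y)` (`s(z) • i = z`) and the **Iwasawa
  homeomorphism** `iwasawa : ℍ × K ≃ₜ SL(2, ℝ)`, `(z, k) ↦ s(z) k`.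
* `Literature.SL2R.haar := (volume ⊗ haarK).map iwasawa`: left invariant because left multiplication
  by `h` reads `(z, k) ↦ (h • z, κ(h, z) k)` in Iwasawa coordinates (a skew product of the
  area-preserving Möbius map with left translations of `K`); finite on compacts and positive on
  opens, hence a Haar measure, hence also right invariant; and its push-forward under
  `g ↦ g • i` is exactly the hyperbolic area (`Literature.Probability.RandomPlanarGeometry.SL2R.map_smul_I_haar`,
  `Literature.Probability.RandomPlanarGeometry.SL2R.haar_preimage_smul`, `Literature.Probability.RandomPlanarGeometry.SL2R.haar_preimage_smul_null`).

## References

* S. Lang, *SL₂(ℝ)*, Graduate Texts in Mathematics 105, Springer (1985), Ch. III §1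
  (Iwasawa decomposition, the Haar measure `dx dy y⁻² dθ`, unimodularity).
* A. W. Knapp, *Lie Groups Beyond an Introduction*, 2nd ed., Birkhäuser (2002), Ch. VIII §2
  (modular function; semisimple and, more generally, unipotently generated groups are unimodular).

## Mathlib

Uses `UpperHalfPlane`'s `volume` and its `GL(2, ℝ)`-invariance
(`Mathlib.Analysis.Complex.UpperHalfPlane.Measure`), properness of `g ↦ g • i`
(`UpperHalfPlane.isProperMap_smul_I`), `MeasureTheory.Measure.modularCharacter`,
uniqueness of Haar measure (`isMulLeftInvariant_eq_smul`) and `MeasurePreserving.skew_product`.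
Mathlib registers no `MeasurableSpace` on `SL(2, ℝ)`; the Borel one is registered here.
-/

noncomputable section

open MeasureTheory MeasureTheory.Measure UpperHalfPlane Matrix Set Filter Topology
open scoped MatrixGroups NNReal ENNReal

namespace Literature.Probability.RandomPlanarGeometry

namespace SL2R

/-! ### Topological and Borel structure -/

/-- `SL(2, ℝ)` carries the Borel σ-algebra of its (subspace-of-matrices) topology
(Lang, *SL₂(ℝ)*, Ch. III §1). [folklore] -/
instance instMeasurableSpace : MeasurableSpace SL(2, ℝ) := borel _

/-- The σ-algebra on `SL(2, ℝ)` is Borel by definition. [folklore] -/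
instance instBorelSpace : BorelSpace SL(2, ℝ) := ⟨rfl⟩

/-- `SL(2, ℝ)` is Hausdorff (closed subset of the matrices). [folklore] -/
instance instT2Space : T2Space SL(2, ℝ) :=
  Matrix.SpecialLinearGroup.isClosedEmbedding_val.isEmbedding.t2Space

/-- `SL(2, ℝ)` is second countable (subspace of `ℝ^{2×2}`). [folklore] -/
instance instSecondCountableTopology : SecondCountableTopology SL(2, ℝ) :=
  haveI : SecondCountableTopology (Matrix (Fin 2) (Fin 2) ℝ) :=
    inferInstanceAs (SecondCountableTopology (Fin 2 → Fin 2 → ℝ))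
  Matrix.SpecialLinearGroup.isClosedEmbedding_val.isEmbedding.secondCountableTopology

/-- `SL(2, ℝ)` is locally compact (closed subset of `ℝ^{2×2}`). [folklore] -/
instance instLocallyCompactSpace : LocallyCompactSpace SL(2, ℝ) :=
  haveI : LocallyCompactSpace (Matrix (Fin 2) (Fin 2) ℝ) :=
    inferInstanceAs (LocallyCompactSpace (Fin 2 → Fin 2 → ℝ))
  Matrix.SpecialLinearGroup.isClosedEmbedding_val.locallyCompactSpace

/-! ### Unipotent elements and unimodularity -/

/-- The upper unipotent `u(x) = (1 x; 0 1)`. [folklore] -/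
def upperUnipotent (x : ℝ) : SL(2, ℝ) := ⟨!![1, x; 0, 1], by simp⟩

/-- The lower unipotent `l(x) = (1 0; x 1)`. [folklore] -/
def lowerUnipotent (x : ℝ) : SL(2, ℝ) := ⟨!![1, 0; x, 1], by simp⟩

/-- The diagonal element `d = (√2 0; 0 1/√2)`. [folklore] -/
def diagSqrtTwo : SL(2, ℝ) :=
  ⟨!![Real.sqrt 2, 0; 0, (Real.sqrt 2)⁻¹], by simp⟩

/-- Entries of `u(x)`. [folklore] -/
@[simp] lemma coe_upperUnipotent (x : ℝ) :
    (upperUnipotent x : Matrix (Fin 2) (Fin 2) ℝ) = !![1, x; 0, 1] := rfl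

/-- Entries of `l(x)`. [folklore] -/
@[simp] lemma coe_lowerUnipotent (x : ℝ) :
    (lowerUnipotent x : Matrix (Fin 2) (Fin 2) ℝ) = !![1, 0; x, 1] := rfl

/-- Entries of `d`. [folklore] -/
@[simp] lemma coe_diagSqrtTwo :
    (diagSqrtTwo : Matrix (Fin 2) (Fin 2) ℝ) = !![Real.sqrt 2, 0; 0, (Real.sqrt 2)⁻¹] := rfl

/-- `d u(x) = u(x) u(x) d`: conjugation by `d` doubles the upper unipotent parameter. [folklore] -/
lemma diagSqrtTwo_mul_upperUnipotent (x : ℝ) :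
    diagSqrtTwo * upperUnipotent x = upperUnipotent x * upperUnipotent x * diagSqrtTwo := by
  ext i j
  have h2 : Real.sqrt 2 ^ 2 = 2 := Real.sq_sqrt (by norm_num)
  have h2' : Real.sqrt 2 ≠ 0 := by positivity
  fin_cases i <;> fin_cases j <;> simp [Matrix.mul_apply, Fin.sum_univ_two]
  field_simp
  rw [h2]
  ring

/-- `d l(x)² = l(x) d`: conjugation by `d⁻¹` doubles the lower unipotent parameter. [folklore] -/
lemma diagSqrtTwo_mul_lowerUnipotent_sq (x : ℝ) :
    diagSqrtTwo * (lowerUnipotent x * lowerUnipotent x) = lowerUnipotent x * diagSqrtTwo := by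
  ext i j
  have h2 : Real.sqrt 2 ^ 2 = 2 := Real.sq_sqrt (by norm_num)
  have h2' : Real.sqrt 2 ≠ 0 := by positivity
  fin_cases i <;> fin_cases j <;> simp [Matrix.mul_apply, Fin.sum_univ_two]
  field_simp
  rw [h2]
  ring

/-- Bruhat-type factorisation: a matrix of `SL(2, ℝ)` with non-zero lower-left entry is a product
`u l u` of unipotents (Lang, *SL₂(ℝ)*, Ch. III §1). [folklore] -/
lemma mk_eq_unipotent_prod {a b c d : ℝ} (hdet : a * d - b * c = 1) (hc : c ≠ 0) :
    (⟨!![a, b; c, d], by rwa [Matrix.det_fin_two_of]⟩ : SL(2, ℝ)) =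
      upperUnipotent ((a - 1) / c) * lowerUnipotent c * upperUnipotent ((d - 1) / c) := by
  ext i j
  fin_cases i <;> fin_cases j <;> simp [Matrix.mul_apply, Fin.sum_univ_two]
  · field_simp; ring
  · field_simp; linear_combination -hdet
  · field_simp; ring

/-- The modular character of `SL(2, ℝ)` is trivial on upper unipotents: `Δ(d u d⁻¹) = Δ(u)` while
`d u d⁻¹ = u²` (Lang, *SL₂(ℝ)*, Ch. III §1). [folklore] -/
lemma modularCharacter_upperUnipotent (x : ℝ) : modularCharacter (upperUnipotent x) = 1 := by
  have h := congrArg modularCharacter (diagSqrtTwo_mul_upperUnipotent x)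
  simp only [map_mul] at h
  have hd : modularCharacter diagSqrtTwo ≠ 0 := (modularCharacterFun_pos _).ne'
  have hu : modularCharacter (upperUnipotent x) ≠ 0 := (modularCharacterFun_pos _).ne'
  rw [mul_comm] at h
  have h' := mul_right_cancel₀ hd h
  exact (mul_eq_left₀ hu).1 h'.symm

/-- The modular character of `SL(2, ℝ)` is trivial on lower unipotents. [folklore] -/
lemma modularCharacter_lowerUnipotent (x : ℝ) : modularCharacter (lowerUnipotent x) = 1 := by
  have h := congrArg modularCharacter (diagSqrtTwo_mul_lowerUnipotent_sq x)
  simp only [map_mul] at h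
  have hd : modularCharacter diagSqrtTwo ≠ 0 := (modularCharacterFun_pos _).ne'
  have hl : modularCharacter (lowerUnipotent x) ≠ 0 := (modularCharacterFun_pos _).ne'
  rw [mul_comm] at h
  have h' := mul_right_cancel₀ hd h
  exact (mul_eq_left₀ hl).1 h'

/-- **Unimodularity of `SL(2, ℝ)`**: its modular character is trivial, since `SL(2, ℝ)` is generated
by unipotent elements, on which the character vanishes (Lang, *SL₂(ℝ)*, Ch. III §1;
Knapp, *Lie Groups Beyond an Introduction*, Cor. 8.31: semisimple groups are unimodular). [folklore] -/
theorem modularCharacter_eq_one (g : SL(2, ℝ)) : modularCharacter g = 1 := by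
  -- first the case of a non-zero lower-left entry
  have key : ∀ g : SL(2, ℝ), g 1 0 ≠ 0 → modularCharacter g = 1 := by
    intro g hg
    induction g using Matrix.SpecialLinearGroup.fin_two_induction with
    | h a b c d hdet =>
      have hc : c ≠ 0 := by simpa using hg
      rw [mk_eq_unipotent_prod hdet hc]
      simp [map_mul, modularCharacter_upperUnipotent, modularCharacter_lowerUnipotent]
  by_cases hg : g 1 0 ≠ 0
  · exact key g hg
  · push Not at hg
    -- `g = l(-1) (l(1) g)` and `l(1) g` has lower-left entry `g₀₀ ≠ 0`
    have h1 : g = lowerUnipotent (-1) * (lowerUnipotent 1 * g) := by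
      rw [← mul_assoc]
      have : lowerUnipotent (-1) * lowerUnipotent 1 = 1 := by
        ext i j; fin_cases i <;> fin_cases j <;> simp [Matrix.mul_apply, Fin.sum_univ_two]
      rw [this, one_mul]
    have h00 : g 0 0 ≠ 0 := by
      intro h0
      have hdet := Matrix.SpecialLinearGroup.det_coe g
      rw [Matrix.det_fin_two, hg, h0] at hdet
      simp at hdet
    have h2 : (lowerUnipotent 1 * g) 1 0 ≠ 0 := by
      simpa [Matrix.mul_apply, Fin.sum_univ_two, hg] using h00
    rw [h1, map_mul, modularCharacter_lowerUnipotent, one_mul, key _ h2]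

/-- Every Haar measure on `SL(2, ℝ)` is right invariant (unimodularity; Lang, *SL₂(ℝ)*,
Ch. III §1). Proof: for the regular Haar measure `haarMeasure K₀` right translation multiplies the
measure by the (trivial) modular character; a general Haar measure is a multiple of it. [folklore] -/
theorem isMulRightInvariant_of_isHaarMeasure (μ : Measure SL(2, ℝ)) [IsHaarMeasure μ] :
    IsMulRightInvariant μ := by
  set K₀ : TopologicalSpace.PositiveCompacts SL(2, ℝ) := Classical.arbitrary _
  set μ₀ : Measure SL(2, ℝ) := haarMeasure K₀
  have h₀ : ∀ g : SL(2, ℝ), Measure.map (· * g) μ₀ = μ₀ := fun g ↦ by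
    rw [map_right_mul_eq_modularCharacterFun_smul μ₀ g]
    have : modularCharacterFun g = 1 := modularCharacter_eq_one g
    rw [this, one_smul]
  have hμ : μ = haarScalarFactor μ μ₀ • μ₀ := isMulLeftInvariant_eq_smul μ μ₀
  refine ⟨fun g ↦ ?_⟩
  rw [hμ, Measure.map_smul, h₀ g]

/-! ### Positivity of the hyperbolic area of open sets -/

/-- The hyperbolic area `volume` on `ℍ` gives positive mass to non-empty open sets. [folklore] -/
instance instIsOpenPosMeasureVolumeUpperHalfPlane : IsOpenPosMeasure (volume : Measure ℍ) := by
  refine ⟨fun U hU hne ↦ ?_⟩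
  have hg : Continuous fun z : ℍ ↦ (NNReal.mk z.im z.im_pos.le : ℝ≥0) :=
    continuous_im.subtype_mk _
  have hf : Continuous fun z : ℍ ↦ ((1 / NNReal.mk z.im z.im_pos.le) ^ 2 : ℝ≥0) :=
    (continuous_const.div₀ hg fun x ↦ NNReal.ne_iff.mp x.im_ne_zero).pow 2
  have hfm : Measurable fun z : ℍ ↦ (((1 / NNReal.mk z.im z.im_pos.le) ^ 2 : ℝ≥0) : ℝ≥0∞) :=
    (ENNReal.continuous_coe.comp hf).measurable
  rw [volume_def, Ne, withDensity_apply_eq_zero hfm]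
  have hne' : {z : ℍ | (((1 / NNReal.mk z.im z.im_pos.le) ^ 2 : ℝ≥0) : ℝ≥0∞) ≠ 0} ∩ U = U := by
    refine inter_eq_right.2 fun z _ ↦ ?_
    have : (0 : ℝ≥0) < 1 / NNReal.mk z.im z.im_pos.le := one_div_pos.2 (by exact_mod_cast z.im_pos)
    exact_mod_cast (pow_pos this 2).ne'
  rw [hne', MeasurableEmbedding.comap_apply measurableEmbedding_coe]
  exact (isOpenEmbedding_coe.isOpenMap U hU).measure_ne_zero volume (hne.image _)

/-! ### The stabiliser of `i` and its normalised Haar measure -/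

/-- The stabiliser `K = Stab(i) ≅ SO(2)` of `i ∈ ℍ` in `SL(2, ℝ)` (Lang, *SL₂(ℝ)*, Ch. III §1). [folklore] -/
abbrev stabI : Subgroup SL(2, ℝ) := MulAction.stabilizer SL(2, ℝ) UpperHalfPlane.I

/-- `K = Stab(i)` is compact: it is the preimage of `{i}` under the proper orbit map `g ↦ g • i`
(Mathlib `UpperHalfPlane.isProperMap_smul_I`). [folklore] -/
theorem isCompact_stabI : IsCompact ((stabI : Subgroup SL(2, ℝ)) : Set SL(2, ℝ)) := by
  have h := isProperMap_smul_I.isCompact_preimage (isCompact_singleton (x := UpperHalfPlane.I))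
  convert h using 1
  ext g
  simp [MulAction.mem_stabilizer_iff]

/-- `K = Stab(i)` is a compact group. [folklore] -/
instance instCompactSpaceStabI : CompactSpace stabI :=
  isCompact_iff_compactSpace.mp isCompact_stabI

/-- The Haar probability measure on the compact group `K = Stab(i)`. [folklore] -/
def haarK : Measure stabI := haarMeasure ⊤

/-- `haarK` is a Haar measure. [folklore] -/
instance instIsHaarMeasureHaarK : IsHaarMeasure haarK := by
  unfold haarK; infer_instance

/-- `haarK` is a probability measure (normalised on the compact group). [folklore] -/
instance instIsProbabilityMeasureHaarK : IsProbabilityMeasure haarK :=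
  ⟨by rw [haarK]; simpa using (haarMeasure_self (G := stabI) (K₀ := ⊤))⟩

/-! ### The Iwasawa section and homeomorphism -/

/-- The square root of the imaginary part of a point of `ℍ` is non-zero. [folklore] -/
lemma sqrt_im_ne_zero (z : ℍ) : Real.sqrt z.im ≠ 0 :=
  (Real.sqrt_pos.2 z.im_pos).ne'

/-- The **Iwasawa section** `s(x + iy) = (√y, x/√y; 0, 1/√y) ∈ SL(2, ℝ)`, the unique upper
triangular matrix with positive diagonal mapping `i` to `x + iy` (Lang, *SL₂(ℝ)*, Ch. III §1). [folklore] -/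
def iwasawaS (z : ℍ) : SL(2, ℝ) :=
  ⟨!![Real.sqrt z.im, z.re / Real.sqrt z.im; 0, (Real.sqrt z.im)⁻¹], by
    rw [Matrix.det_fin_two_of]
    field_simp [sqrt_im_ne_zero z]
    ring⟩

/-- Entries of the Iwasawa section. [folklore] -/
@[simp] lemma coe_iwasawaS (z : ℍ) : (iwasawaS z : Matrix (Fin 2) (Fin 2) ℝ) =
    !![Real.sqrt z.im, z.re / Real.sqrt z.im; 0, (Real.sqrt z.im)⁻¹] := rfl

/-- `s(z) • i = z` (Lang, *SL₂(ℝ)*, Ch. III §1). [folklore] -/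
@[simp] lemma iwasawaS_smul_I (z : ℍ) : iwasawaS z • UpperHalfPlane.I = z := by
  apply UpperHalfPlane.ext
  rw [coe_specialLinearGroup_apply]
  have h0 : (Real.sqrt z.im : ℂ) ≠ 0 := by exact_mod_cast sqrt_im_ne_zero z
  have hsq : ((Real.sqrt z.im : ℂ)) ^ 2 = (z.im : ℂ) := by
    rw [← Complex.ofReal_pow, Real.sq_sqrt z.im_pos.le]
  simp only [coe_iwasawaS, Matrix.of_apply, Matrix.cons_val', Matrix.cons_val_zero,
    Matrix.cons_val_one, Matrix.cons_val_fin_one, Algebra.algebraMap_self, RingHom.id_apply,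
    Complex.ofReal_zero, zero_mul, zero_add, Complex.ofReal_inv, Complex.ofReal_div, coe_I]
  conv_rhs => rw [← UpperHalfPlane.re_add_im z]
  field_simp
  rw [hsq]
  ring

/-- The Iwasawa section is continuous. [folklore] -/
theorem continuous_iwasawaS : Continuous iwasawaS := by
  refine continuous_induced_rng.2 ?_
  have hs : Continuous fun z : ℍ ↦ Real.sqrt z.im := Real.continuous_sqrt.comp continuous_im
  have hsi : Continuous fun z : ℍ ↦ (Real.sqrt z.im)⁻¹ := hs.inv₀ sqrt_im_ne_zero
  refine continuous_matrix fun i j ↦ ?_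
  fin_cases i <;> fin_cases j
  · simpa using hs
  · have hre : Continuous fun z : ℍ ↦ z.re := continuous_re
    refine (hre.div hs sqrt_im_ne_zero).congr fun z ↦ ?_
    simp
  · simpa using continuous_const
  · simpa using hsi

/-- An element of the stabiliser fixes `i`. [folklore] -/
@[simp] lemma stabI_smul_I (k : stabI) : (k : SL(2, ℝ)) • UpperHalfPlane.I = UpperHalfPlane.I :=
  MulAction.mem_stabilizer_iff.1 k.2

/-- `s(g • i)⁻¹ g` fixes `i`. [folklore] -/
lemma inv_iwasawaS_mul_mem (g : SL(2, ℝ)) :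
    (iwasawaS (g • UpperHalfPlane.I))⁻¹ * g ∈ stabI := by
  rw [MulAction.mem_stabilizer_iff, mul_smul, inv_smul_eq_iff, iwasawaS_smul_I]

/-- The **Iwasawa homeomorphism** `ℍ × K ≃ₜ SL(2, ℝ)`, `(z, k) ↦ s(z) k`, with inverse
`g ↦ (g • i, s(g • i)⁻¹ g)` (Lang, *SL₂(ℝ)*, Ch. III §1: `G = (AN) K` topologically). [folklore] -/
def iwasawa : ℍ × stabI ≃ₜ SL(2, ℝ) where
  toFun p := iwasawaS p.1 * p.2
  invFun g := (g • UpperHalfPlane.I, ⟨(iwasawaS (g • UpperHalfPlane.I))⁻¹ * g, inv_iwasawaS_mul_mem g⟩)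
  left_inv p := by
    obtain ⟨z, k⟩ := p
    have hz : (iwasawaS z * k) • UpperHalfPlane.I = z := by rw [mul_smul, stabI_smul_I, iwasawaS_smul_I]
    ext1
    · exact hz
    · apply Subtype.ext
      simp only [hz, inv_mul_cancel_left]
  right_inv g := by simp only [mul_inv_cancel_left]
  continuous_toFun := (continuous_iwasawaS.comp continuous_fst).mul
    (continuous_subtype_val.comp continuous_snd)
  continuous_invFun := by
    refine Continuous.prodMk (continuous_id.smul continuous_const) ?_
    refine Continuous.subtype_mk ?_ _
    exact ((continuous_iwasawaS.comp (continuous_id.smul continuous_const)).inv).mul continuous_id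

/-- Unfolding the Iwasawa homeomorphism. [folklore] -/
@[simp] lemma iwasawa_apply (p : ℍ × stabI) : iwasawa p = iwasawaS p.1 * p.2 := rfl

/-- The orbit map composed with the Iwasawa homeomorphism is the first projection:
`(s(z) k) • i = z`. [folklore] -/
@[simp] lemma iwasawa_smul_I (p : ℍ × stabI) : iwasawa p • UpperHalfPlane.I = p.1 := by
  rw [iwasawa_apply, mul_smul, stabI_smul_I, iwasawaS_smul_I]

/-! ### The Haar measure in Iwasawa coordinates -/

/-- The measure `dx dy / y² ⊗ dk` transported to `SL(2, ℝ)` by the Iwasawa homeomorphism: a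
bi-invariant Haar measure on `SL(2, ℝ)` (Lang, *SL₂(ℝ)*, Ch. III §1). [folklore] -/
def haar : Measure SL(2, ℝ) := ((volume : Measure ℍ).prod haarK).map iwasawa

/-- The `K`-part of `h s(z)`: the element `κ(h, z) = s(h • z)⁻¹ h s(z)` of `K`, so that
`h s(z) = s(h • z) κ(h, z)`. [folklore] -/
def kPart (h : SL(2, ℝ)) (z : ℍ) : stabI :=
  ⟨(iwasawaS (h • z))⁻¹ * (h * iwasawaS z), by
    have := inv_iwasawaS_mul_mem (h * iwasawaS z)
    rwa [mul_smul, iwasawaS_smul_I] at this⟩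

/-- `κ(h, ·)` is continuous. [folklore] -/
theorem continuous_kPart (h : SL(2, ℝ)) : Continuous (kPart h) := by
  refine Continuous.subtype_mk ?_ _
  exact ((continuous_iwasawaS.comp (continuous_const.smul continuous_id)).inv).mul
    (continuous_const.mul continuous_iwasawaS)

/-- Left multiplication in Iwasawa coordinates is a skew product:
`h (s(z) k) = s(h • z) (κ(h, z) k)`. [folklore] -/
lemma mul_iwasawa (h : SL(2, ℝ)) (p : ℍ × stabI) :
    h * iwasawa p = iwasawa (h • p.1, kPart h p.1 * p.2) := by
  simp only [iwasawa_apply, kPart, Subgroup.coe_mul, mul_inv_cancel_left, mul_assoc]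

/-- `SL(2, ℝ)` preserves the hyperbolic area (Mathlib: invariance under `GL(2, ℝ)`). [folklore] -/
theorem measurePreserving_smul_upperHalfPlane (h : SL(2, ℝ)) :
    MeasurePreserving (h • · : ℍ → ℍ) volume volume :=
  measurePreserving_smul (Matrix.SpecialLinearGroup.mapGL ℝ h) volume

/-- The skew product `(z, k) ↦ (h • z, κ(h, z) k)` preserves `vol_ℍ ⊗ haar_K`. [folklore] -/
theorem measurePreserving_skew (h : SL(2, ℝ)) :
    MeasurePreserving (fun p : ℍ × stabI ↦ (h • p.1, kPart h p.1 * p.2))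
      ((volume : Measure ℍ).prod haarK) ((volume : Measure ℍ).prod haarK) := by
  refine (measurePreserving_smul_upperHalfPlane h).skew_product (g := fun z k ↦ kPart h z * k)
    ?_ (Eventually.of_forall fun z ↦ map_mul_left_eq_self haarK _)
  exact ((continuous_kPart h).comp continuous_fst).mul continuous_snd |>.measurable

/-- `haar` is left invariant (Lang, *SL₂(ℝ)*, Ch. III §1: `dx dy/y² dθ` is a left Haar measure). [folklore] -/
instance instIsMulLeftInvariantHaar : IsMulLeftInvariant haar := by
  refine ⟨fun h ↦ ?_⟩
  rw [haar, Measure.map_map (measurable_const_mul h) iwasawa.measurable]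
  have : (fun x ↦ h * x) ∘ iwasawa = iwasawa ∘ fun p : ℍ × stabI ↦ (h • p.1, kPart h p.1 * p.2) :=
    funext (mul_iwasawa h)
  rw [this, ← Measure.map_map iwasawa.measurable (measurePreserving_skew h).measurable,
    (measurePreserving_skew h).map_eq]

/-- `haar` is finite on compact sets. [folklore] -/
instance instIsFiniteMeasureOnCompactsHaar : IsFiniteMeasureOnCompacts haar := by
  refine ⟨fun K hK ↦ ?_⟩
  rw [haar, Measure.map_apply iwasawa.measurable hK.measurableSet]
  exact (iwasawa.isCompact_preimage.2 hK).measure_lt_top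

/-- `haar` is positive on non-empty open sets. [folklore] -/
instance instIsOpenPosMeasureHaar : IsOpenPosMeasure haar := by
  refine ⟨fun U hU hne ↦ ?_⟩
  rw [haar, Measure.map_apply iwasawa.measurable hU.measurableSet]
  exact (hU.preimage iwasawa.continuous).measure_ne_zero _ (iwasawa.surjective.nonempty_preimage.2 hne)

/-- `haar` is a Haar measure on `SL(2, ℝ)`. [folklore] -/
instance instIsHaarMeasureHaar : IsHaarMeasure haar where

/-- `haar` is right invariant (unimodularity of `SL(2, ℝ)`). [folklore] -/
instance instIsMulRightInvariantHaar : IsMulRightInvariant haar :=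
  isMulRightInvariant_of_isHaarMeasure haar

/-- The orbit map `g ↦ g • i` is measurable. [folklore] -/
theorem measurable_smul_I : Measurable fun g : SL(2, ℝ) ↦ g • UpperHalfPlane.I :=
  (continuous_id.smul continuous_const).measurable

/-- **Orbit disintegration**: the push-forward of `haar` under the orbit map `g ↦ g • i` is the
hyperbolic area on `ℍ` (Lang, *SL₂(ℝ)*, Ch. III §1: `dg = dx dy/y² · dθ`). [folklore] -/
theorem map_smul_I_haar :
    Measure.map (fun g : SL(2, ℝ) ↦ g • UpperHalfPlane.I) haar = volume := by
  rw [haar, Measure.map_map measurable_smul_I iwasawa.measurable]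
  have : (fun g : SL(2, ℝ) ↦ g • UpperHalfPlane.I) ∘ iwasawa = Prod.fst := funext iwasawa_smul_I
  rw [this, Measure.map_fst_prod, measure_univ, one_smul]

/-- The `haar`-measure of `{g | g • i ∈ s}` is the hyperbolic area of `s` (measurable `s`). [folklore] -/
theorem haar_preimage_smul_I {s : Set ℍ} (hs : MeasurableSet s) :
    haar {g : SL(2, ℝ) | g • UpperHalfPlane.I ∈ s} = volume s := by
  rw [← map_smul_I_haar, Measure.map_apply measurable_smul_I hs]
  rfl

/-- The `haar`-measure of `{g | g • z₀ ∈ s}` is the hyperbolic area of `s`, for any base point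
`z₀` (right invariance moves the base point). [folklore] -/
theorem haar_preimage_smul {s : Set ℍ} (hs : MeasurableSet s) (z₀ : ℍ) :
    haar {g : SL(2, ℝ) | g • z₀ ∈ s} = volume s := by
  have hm : MeasurableSet ((fun g : SL(2, ℝ) ↦ g • UpperHalfPlane.I) ⁻¹' s) := measurable_smul_I hs
  calc haar {g : SL(2, ℝ) | g • z₀ ∈ s}
        = haar ((· * iwasawaS z₀) ⁻¹' ((fun g : SL(2, ℝ) ↦ g • UpperHalfPlane.I) ⁻¹' s)) := by
          congr 1; ext g; simp [mul_smul]
    _ = Measure.map (· * iwasawaS z₀) haar ((fun g : SL(2, ℝ) ↦ g • UpperHalfPlane.I) ⁻¹' s) :=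
          (Measure.map_apply (measurable_mul_const _) hm).symm
    _ = volume s := by rw [map_mul_right_eq_self]; exact haar_preimage_smul_I hs

/-- Null sets of `ℍ` pull back to `haar`-null sets under every orbit map `g ↦ g • z₀`
(no measurability needed). [folklore] -/
theorem haar_preimage_smul_null {s : Set ℍ} (hs : volume s = 0) (z₀ : ℍ) :
    haar {g : SL(2, ℝ) | g • z₀ ∈ s} = 0 := by
  refine measure_mono_null (fun g (hg : g • z₀ ∈ s) ↦ subset_toMeasurable volume s hg) ?_
  change haar {g : SL(2, ℝ) | g • z₀ ∈ toMeasurable volume s} = 0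
  rw [haar_preimage_smul (measurableSet_toMeasurable _ _), measure_toMeasurable, hs]

end SL2R

end Literature.Probability.RandomPlanarGeometry
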